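import Summits.NavierStokesRegularity.FluidComputer.GateBudgetThirdIgnition
import HarnessLib

/-!
# What no tuning can beat, part 48: THE PER-PULSE LEAK IS THE LATTICE SLIP — on the lattice
# `ε = kK¹⁰ρ²` a pulse that keeps its clock-pair radius `νε` is pinned to `kπ` within
# `kπ/(ν²K¹⁰ - 1) + K⁻¹⁹` (member-wise `Θ(k/K¹⁰)`; uniformly `≤ π/(200ν²) + 2⁻⁷⁶`), not part
# 22's `7/100`: the generic pin, the lattice index `1 ≤ k ≤ K¹⁰/200`, and the ladder step

Cell `pub-fluidc`, blueprint seat bp1 (gen 34, first item, FILE 1 of 2); same namespace and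
conventions as parts 1–47 (`GateBudget*.lean`); imports part 47 (`GateBudgetThirdIgnition`, the
tip of the chain; used here: part 9's `headline_pow_floor`, `headline_exp_le`). Headline
amplifier `M = K¹⁰`, `K ≥ 16`; modes `0 = a` carrier, `1 = b` clock, `2 = c` trigger, `3 = d`
transfer, `4 = ã` output of `rotorCircuit K K¹⁰ ε ρ` from (5.6); `λ₀ = K⁻¹⁰ + 4e^{-K¹⁰}/K¹⁰`.
HONEST FRAMING (verbatim): low prior, high value-of-information experiment on Tao's machine
paradigm; NOT a claim that NS blows up. Nothing is proved about the Navier–Stokes equations.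

THE QUESTION (SPEC-INPUT-bp1 §AT item (19b⁵), THE PER-PULSE LEAK). Parts 42/46 pin the second
pulse's phase `Φ₂ = (C(T₂) - C(r₁))/ρ²` of a lattice dud to `kπ ± 7/100`, and `7/100` squared
(`0.0049` of output pair per pulse) closes the misfire induction for `≈ 5` pulses only. Is the
`7/100` an artefact of the bookkeeping for EXACT lattice members? ANSWER, read off part 16's
bracket `w(π - η - D) ≤ Φ ≤ w(π + D)/(1 - q)` (`w = ε/(K¹⁰ρ²) = k` on the lattice, swing defect
`η`, seed drift `D`, critical ratio `q = ε²/(K¹⁰ϱ²)` on a clock-pair ring of radius `ϱ`) and part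
41's `pin_of_bracket` (`|Φ - kπ| ≤ k(η + (πq + D)/(1 - q))`):
* MOSTLY YES. Part 41's `second_psi_le` spends `k ≤ 2ε/(K¹⁰ρ²) = 2k` (a factor `2`) and the
  ring `ϱ = 0.7ε` of part 18's window (`q = 100/(49K¹⁰)`, a factor `1.943/0.49 ≈ 4` against the
  radius the pulse actually keeps), and part 22's `teeth_psi` then spends `k ≤ K¹⁰/100`:
  `2k·π·100/(49K¹⁰) ≤ π/49 = 0.0641`, plus change `= 7/100`. With part 45's KEPT RADIUS
  (`|b² + c² - (b(r₁)² + c(r₁)²)| ≤ ε²/10⁶` on `[r₁, T₂]`, `b(r₁) ≥ 1.394ε`, so `b² + c² ≥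
  (1.3939ε)²` throughout the pulse) and the exact `k`: §142 `lattice_pin_le` — for entry clock
  `≥ θ₁ε` (`θ₁ ≥ 5/4`), exit clock `≤ -θ₂ε` (`θ₂ ≥ 1`), ring `νε` (`ν ≥ 1`), pulse length
  `≤ 242/K⁹`: `k(η + (πq + D)/(1 - q)) ≤ kπ/(ν²K¹⁰ - 1) + 1/K¹⁹` (the swing arctangents cost
  `≤ 0.8/K¹⁹ + 1.0001/K²⁰`, the seed drift `≤ 10⁻⁸/K²⁰`; the slip `kπq/(1 - q) = kπ/(ν²K¹⁰ - 1)`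
  EXACTLY); §143 `lattice_index_bounds`: `1 ≤ k ≤ K¹⁰/200` on the window; so uniformly
  `|Φ₂ - kπ| ≤ π/(200·1.943 - 2⁻⁴⁰) + 2⁻⁷⁶ ≤ 81/10⁴` — NINE times below `7/100` (FILE 2, part
  49 `GateBudgetSharpPin`, instantiates this on part 46's master tuple).
* BUT NOT ENTIRELY. The slip `kπq/(1 - q) ≈ kπ/(ν²K¹⁰)` is not bookkeeping: by part 14's phase
  law `dΦ/dt·ρ² = c = -(d/dt)arctan(b/c)/μ + (εa²c - σa²b)/(μ(b² + c²))` the term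
  `k·∫εa²c/(b² + c²)` is SIGN-DEFINITE and of true size `≈ (k/K¹⁰)·(π/2)·ε²/r̄² ≈ 0.76k/K¹⁰`
  (not certified here: a lower bound needs the carrier tracked through the pulse). So the
  per-pulse transfer `|d(T₂)| - |d(r₁)| ≲ kπ/(ν²K¹⁰)` is `Θ(k/K¹⁰)`: `≈ 0.008` at the bottom of
  the window (`k = K¹⁰/200`), `≈ 3·10⁻¹²` at its top (`k = 1`) — NEITHER of §AT's two guesses
  (`O(K⁻⁸)` uniformly / `0.005` uniformly). The misfire ladder is FINITE FOR EVERY MEMBER and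
  its length is member-wise: `N_k ≈ 0.12/(kπ/(ν²K¹⁰) + 1.2·10⁻⁶)` pulses with the present drift
  constants (`≥ 15` for every member, `≈ 10⁵` near the top of the window); no member is
  certified stationary by this bookkeeping, and (20′) must be posed as a ladder length
  `N(k, K)`, not "for all time".
* §144 `pair_sqrt_step`: the triangle inequality in `ℝ²` that turns the per-pulse transfer and
  output bounds into ONE step of `√(d² + ã²)` (the quantity the ladder inducts on; the pair
  `P = d² + ã²` has `dP/dt = 2ρ⁻²cad` EXACTLY — the output drain cancels — so `√P` moves by at
  most the dose `∫ρ⁻²c` between pulses and by the pin during one).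

HONEST LIMITS. (i) Upper side only: the sign-definite lower bound on the slip (`≈ 0.74k/K¹⁰`)
is a reading of part 14's phase law, not a theorem here; (ii) the drift constant `10⁻⁶` of the
ladder is part 14's with `|ã| ≤ 1` and is what caps `N_k` near the top of the window; (iii)
pure real arithmetic: no trajectory enters this file (FILE 2 does the dynamics); `K ≥ 16`;
(iv) nothing about Navier–Stokes.
[cite: Tao2016AveragedNS, §5.5 Theorem 5.3, (5.5), (5.6), (b-eq), (c-eq)]
-/

noncomputable section

namespace Summit.NavierStokesRegularity.FluidComputer.GateBudget

open Real Set Filter Topology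
open Literature.Analysis.FluidPDE.Tao2016AveragedNS

variable {K ε ρ : ℝ} {X : ℝ → Fin 5 → ℝ} {C : ℝ → ℝ}

/-! ## §142 The lattice pin: the phase budget of a pulse that keeps its radius -/

/-- **THE LATTICE PIN.** On the lattice `ε = kK¹⁰ρ²` (`K ≥ 16`, `0 < ε`, `0 < ρ`), for a pulse
of length `0 ≤ τ ≤ 242/K⁹` entered with clock `≥ θ₁ε` (`θ₁ ≥ 5/4`) and trigger `≤ ρ²/K⁹`, left
with clock `≤ -θ₂ε` (`θ₂ ≥ 1`) and trigger `≤ λ₀ρ²`, on a clock-pair ring of radius `νε`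
(`ν ≥ 1`): `k` times (swing defect `arctan((ρ²/K⁹)/(θ₁ε)) + arctan(λ₀ρ²/(θ₂ε))` plus the
excess `(πq + ρ²e^{-K¹⁰}τ/(νε))/(1 - q)`, `q = ε²/(K¹⁰(νε)²) = 1/(ν²K¹⁰)`) is at most
`kπ/(ν²K¹⁰ - 1) + 1/K¹⁹` (`arctan x ≤ x`, `kρ² = ε/K¹⁰`, `λ₀ ≤ (1 + 4/K¹⁰)/K¹⁰`,
`e^{-K¹⁰} ≤ 1/K¹⁰`; the slip `kπq/(1 - q) = kπ/(ν²K¹⁰ - 1)` is kept exactly).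
[cite: Tao2016AveragedNS, §5.5 Theorem 5.3, (b-eq), (c-eq)] -/
theorem lattice_pin_le {τ θ₁ θ₂ ν : ℝ} (k : ℕ) (hk : ε = k * K ^ 10 * ρ ^ 2) (hε : 0 < ε)
    (hρ : 0 < ρ) (hK : 16 ≤ K) (hτ0 : 0 ≤ τ) (hτ : τ ≤ 242 / K ^ 9) (hθ₁ : 5 / 4 ≤ θ₁)
    (hθ₂ : 1 ≤ θ₂) (hν : 1 ≤ ν) :
    k * (arctan (ρ ^ 2 / K ^ 9 / (θ₁ * ε))
        + arctan ((1 / K ^ 10 + 4 * exp (-K ^ 10) / K ^ 10) * ρ ^ 2 / (θ₂ * ε))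
        + (π * (ε ^ 2 / (K ^ 10 * (ν * ε) ^ 2)) + ρ ^ 2 * exp (-K ^ 10) * τ / (ν * ε))
          / (1 - ε ^ 2 / (K ^ 10 * (ν * ε) ^ 2)))
      ≤ k * π / (ν ^ 2 * K ^ 10 - 1) + 1 / K ^ 19 := by
  have harc : ∀ {x : ℝ}, 0 ≤ x → arctan x ≤ x := fun {x} hx => by
    have h := Real.le_tan (Real.arctan_nonneg.2 hx) (Real.arctan_lt_pi_div_two x)
    rwa [Real.tan_arctan] at h
  have hK0 : 0 < K := by linarith
  have hK9 : 0 < K ^ 9 := by positivity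
  have hK10 : 0 < K ^ 10 := by positivity
  have hθ₁0 : 0 < θ₁ := by linarith
  have hθ₂0 : 0 < θ₂ := by linarith
  have hν0 : 0 < ν := by linarith
  have h9 : (68719476736 : ℝ) ≤ K ^ 9 := by
    have := headline_pow_floor hK 9; norm_num at this; exact this
  have h10 : (1099511627776 : ℝ) ≤ K ^ 10 := by
    have := headline_pow_floor hK 10; norm_num at this; exact this
  have hk0 : (0 : ℝ) ≤ k := Nat.cast_nonneg k
  have he0 : 0 < exp (-K ^ 10) := exp_pos _
  have he := headline_exp_le hK
  -- the units `u = K⁻¹⁰ ≤ p/16`, `p = K⁻⁹`, `K⁻¹⁹ = up`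
  have hu0 : (0 : ℝ) < 1 / K ^ 10 := by positivity
  have hp0 : (0 : ℝ) < 1 / K ^ 9 := by positivity
  have hu1 : (1 : ℝ) / K ^ 10 ≤ 1 / 1099511627776 := one_div_le_one_div_of_le (by norm_num) h10
  have hp1 : (1 : ℝ) / K ^ 9 ≤ 1 / 68719476736 := one_div_le_one_div_of_le (by norm_num) h9
  have hup : (1 : ℝ) / K ^ 10 ≤ 1 / K ^ 9 / 16 := by
    rw [div_div, one_div_le_one_div hK10 (by positivity)]
    nlinarith only [hK, hK9]
  have h19 : (1 : ℝ) / K ^ 19 = 1 / K ^ 10 * (1 / K ^ 9) := by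
    rw [one_div_mul_one_div, ← pow_add]
  -- the lattice identity `kρ² = ε/K¹⁰`
  have hkρ : (k : ℝ) * ρ ^ 2 = ε / K ^ 10 := by
    rw [eq_div_iff hK10.ne']; rw [hk]; ring
  -- the critical ratio `q = 1/(ν²K¹⁰)`
  have hq : ε ^ 2 / (K ^ 10 * (ν * ε) ^ 2) = 1 / (ν ^ 2 * K ^ 10) := by
    rw [div_eq_div_iff (by positivity) (by positivity)]; ring
  rw [hq]
  have hνK : 2 ≤ ν ^ 2 * K ^ 10 := by nlinarith only [hν, h10]
  have hden : 0 < ν ^ 2 * K ^ 10 - 1 := by linarith only [hνK]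
  have hq1 : 0 < 1 - 1 / (ν ^ 2 * K ^ 10) := by
    rw [sub_pos, div_lt_one (by positivity)]; linarith only [hνK]
  have hq2 : 1 / (1 - 1 / (ν ^ 2 * K ^ 10)) ≤ 2 := by
    rw [div_le_iff₀ hq1]
    have : 1 / (ν ^ 2 * K ^ 10) ≤ 1 / 2 := one_div_le_one_div_of_le (by norm_num) hνK
    linarith only [this]
  -- the entry arctangent: `k·(ρ²/K⁹)/(θ₁ε) = 1/(θ₁K¹⁹) ≤ (4/5)up`
  have h1 : (k : ℝ) * arctan (ρ ^ 2 / K ^ 9 / (θ₁ * ε)) ≤ 4 / 5 * (1 / K ^ 10 * (1 / K ^ 9)) := by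
    have hx : 0 ≤ ρ ^ 2 / K ^ 9 / (θ₁ * ε) := by positivity
    have hid : (k : ℝ) * (ρ ^ 2 / K ^ 9 / (θ₁ * ε)) = 1 / θ₁ * (1 / K ^ 10 * (1 / K ^ 9)) := by
      rw [show (k : ℝ) * (ρ ^ 2 / K ^ 9 / (θ₁ * ε)) = k * ρ ^ 2 / (K ^ 9 * (θ₁ * ε)) by ring,
        hkρ]
      field_simp
    have hθ : 1 / θ₁ ≤ (4 : ℝ) / 5 := by
      rw [div_le_div_iff₀ hθ₁0 (by norm_num)]; linarith only [hθ₁]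
    calc (k : ℝ) * arctan (ρ ^ 2 / K ^ 9 / (θ₁ * ε))
        ≤ k * (ρ ^ 2 / K ^ 9 / (θ₁ * ε)) := mul_le_mul_of_nonneg_left (harc hx) hk0
      _ = 1 / θ₁ * (1 / K ^ 10 * (1 / K ^ 9)) := hid
      _ ≤ 4 / 5 * (1 / K ^ 10 * (1 / K ^ 9)) := mul_le_mul_of_nonneg_right hθ (by positivity)
  -- the exit arctangent: `k·λ₀ρ²/(θ₂ε) = λ₀/(θ₂K¹⁰) ≤ (1 + 4u)u² ≤ (10001/10000)u²`
  have h2 : (k : ℝ) * arctan ((1 / K ^ 10 + 4 * exp (-K ^ 10) / K ^ 10) * ρ ^ 2 / (θ₂ * ε))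
      ≤ 10001 / 10000 * (1 / K ^ 10 * (1 / K ^ 10)) := by
    have hl0 : 0 < 1 / K ^ 10 + 4 * exp (-K ^ 10) / K ^ 10 := by positivity
    have hx : 0 ≤ (1 / K ^ 10 + 4 * exp (-K ^ 10) / K ^ 10) * ρ ^ 2 / (θ₂ * ε) := by
      positivity
    have hid : (k : ℝ) * ((1 / K ^ 10 + 4 * exp (-K ^ 10) / K ^ 10) * ρ ^ 2 / (θ₂ * ε))
        = 1 / θ₂ * ((1 / K ^ 10 + 4 * exp (-K ^ 10) / K ^ 10) * (1 / K ^ 10)) := by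
      rw [show (k : ℝ) * ((1 / K ^ 10 + 4 * exp (-K ^ 10) / K ^ 10) * ρ ^ 2 / (θ₂ * ε))
          = (1 / K ^ 10 + 4 * exp (-K ^ 10) / K ^ 10) * (k * ρ ^ 2) / (θ₂ * ε) by ring, hkρ]
      field_simp
    have hθ : 1 / θ₂ ≤ (1 : ℝ) := by rw [div_le_one hθ₂0]; exact hθ₂
    have hlam : (1 / K ^ 10 + 4 * exp (-K ^ 10) / K ^ 10) ≤ 10001 / 10000 * (1 / K ^ 10) := by
      have h4 : 4 * exp (-K ^ 10) / K ^ 10 ≤ 4 * (1 / K ^ 10) * (1 / K ^ 10) := by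
        rw [show 4 * exp (-K ^ 10) / K ^ 10 = 4 * exp (-K ^ 10) * (1 / K ^ 10) by ring]
        exact mul_le_mul_of_nonneg_right (mul_le_mul_of_nonneg_left he (by norm_num)) hu0.le
      nlinarith only [h4, hu1, hu0]
    calc (k : ℝ) * arctan ((1 / K ^ 10 + 4 * exp (-K ^ 10) / K ^ 10) * ρ ^ 2 / (θ₂ * ε))
        ≤ k * ((1 / K ^ 10 + 4 * exp (-K ^ 10) / K ^ 10) * ρ ^ 2 / (θ₂ * ε)) :=
          mul_le_mul_of_nonneg_left (harc hx) hk0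
      _ = 1 / θ₂ * ((1 / K ^ 10 + 4 * exp (-K ^ 10) / K ^ 10) * (1 / K ^ 10)) := hid
      _ ≤ 1 * ((1 / K ^ 10 + 4 * exp (-K ^ 10) / K ^ 10) * (1 / K ^ 10)) :=
          mul_le_mul_of_nonneg_right hθ (by positivity)
      _ ≤ 10001 / 10000 * (1 / K ^ 10 * (1 / K ^ 10)) := by
          rw [one_mul]; nlinarith only [hlam, hu0, hl0]
  -- the seed drift: `k·ρ²e^{-K¹⁰}τ/(νε) = e^{-K¹⁰}τ/(νK¹⁰) ≤ u²/2`
  have h3 : (k : ℝ) * (ρ ^ 2 * exp (-K ^ 10) * τ / (ν * ε))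
      ≤ 1 / 2 * (1 / K ^ 10 * (1 / K ^ 10)) := by
    have hid : (k : ℝ) * (ρ ^ 2 * exp (-K ^ 10) * τ / (ν * ε))
        = 1 / ν * (exp (-K ^ 10) * τ * (1 / K ^ 10)) := by
      rw [show (k : ℝ) * (ρ ^ 2 * exp (-K ^ 10) * τ / (ν * ε))
          = exp (-K ^ 10) * τ * (k * ρ ^ 2) / (ν * ε) by ring, hkρ]
      field_simp
    have hθ : 1 / ν ≤ (1 : ℝ) := by rw [div_le_one hν0]; exact hν
    have hτ1 : τ ≤ 1 / 2 := by
      linarith only [hτ, hp1, show (242:ℝ) / K ^ 9 = 242 * (1 / K ^ 9) by ring]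
    rw [hid]
    calc 1 / ν * (exp (-K ^ 10) * τ * (1 / K ^ 10))
        ≤ 1 * (exp (-K ^ 10) * τ * (1 / K ^ 10)) :=
          mul_le_mul_of_nonneg_right hθ (by positivity)
      _ ≤ 1 * (1 / K ^ 10 * (1 / 2) * (1 / K ^ 10)) := by
          rw [one_mul, one_mul]
          exact mul_le_mul_of_nonneg_right (mul_le_mul he hτ1 hτ0 hu0.le) hu0.le
      _ = 1 / 2 * (1 / K ^ 10 * (1 / K ^ 10)) := by ring
  -- the slip, exactly: `kπq/(1 - q) = kπ/(ν²K¹⁰ - 1)`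
  have h4 : (k : ℝ) * (π * (1 / (ν ^ 2 * K ^ 10))) / (1 - 1 / (ν ^ 2 * K ^ 10))
      = k * π / (ν ^ 2 * K ^ 10 - 1) := by
    have hne : ν ^ 2 * K ^ 10 ≠ 0 := by positivity
    rw [div_eq_div_iff hq1.ne' hden.ne']
    field_simp
  -- assemble
  have hsplit : (k : ℝ) * (arctan (ρ ^ 2 / K ^ 9 / (θ₁ * ε))
        + arctan ((1 / K ^ 10 + 4 * exp (-K ^ 10) / K ^ 10) * ρ ^ 2 / (θ₂ * ε))
        + (π * (1 / (ν ^ 2 * K ^ 10)) + ρ ^ 2 * exp (-K ^ 10) * τ / (ν * ε))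
          / (1 - 1 / (ν ^ 2 * K ^ 10)))
      = k * arctan (ρ ^ 2 / K ^ 9 / (θ₁ * ε))
        + k * arctan ((1 / K ^ 10 + 4 * exp (-K ^ 10) / K ^ 10) * ρ ^ 2 / (θ₂ * ε))
        + (k * (π * (1 / (ν ^ 2 * K ^ 10))) / (1 - 1 / (ν ^ 2 * K ^ 10))
          + k * (ρ ^ 2 * exp (-K ^ 10) * τ / (ν * ε)) * (1 / (1 - 1 / (ν ^ 2 * K ^ 10)))) := by
    field_simp
  rw [hsplit, h4, h19]
  have h5 : (k : ℝ) * (ρ ^ 2 * exp (-K ^ 10) * τ / (ν * ε)) * (1 / (1 - 1 / (ν ^ 2 * K ^ 10)))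
      ≤ 1 / 2 * (1 / K ^ 10 * (1 / K ^ 10)) * 2 :=
    mul_le_mul h3 hq2 (by positivity) (by positivity)
  have huu : 1 / K ^ 10 * (1 / K ^ 10) ≤ 1 / K ^ 10 * (1 / K ^ 9) / 16 := by
    rw [mul_div_assoc]; exact mul_le_mul_of_nonneg_left hup hu0.le
  nlinarith only [h1, h2, h5, huu, mul_pos hu0 hp0]

/-! ## §143 The lattice index on the window: `1 ≤ k ≤ K¹⁰/200` -/

/-- **THE LATTICE INDEX.** On the window `200ε/K²⁰ ≤ ρ²` (`0 < ε`, `0 < ρ`, `0 < K`), a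
lattice member `ε = kK¹⁰ρ²` has `1 ≤ k` and `200k ≤ K¹⁰`. [cite: Tao2016AveragedNS, §5.5 (5.5)] -/
theorem lattice_index_bounds (hK : 0 < K) (hε : 0 < ε) (hρ : 0 < ρ)
    (hlo : 200 * ε / K ^ 20 ≤ ρ ^ 2) (k : ℕ) (hk : ε = k * K ^ 10 * ρ ^ 2) :
    (1 : ℝ) ≤ k ∧ 200 * (k : ℝ) ≤ K ^ 10 := by
  have hK10 : 0 < K ^ 10 := by positivity
  have hρ2 : 0 < ρ ^ 2 := by positivity
  have hk1 : (1 : ℝ) ≤ k := by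
    rcases Nat.eq_zero_or_pos k with h | h
    · rw [h, Nat.cast_zero, zero_mul, zero_mul] at hk; linarith
    · exact_mod_cast h
  refine ⟨hk1, ?_⟩
  rw [div_le_iff₀ (by positivity), hk] at hlo
  -- `200kK¹⁰ρ² ≤ ρ²K²⁰ = ρ²K¹⁰K¹⁰`
  have h1 : 200 * (k : ℝ) * (K ^ 10 * ρ ^ 2) ≤ K ^ 10 * (K ^ 10 * ρ ^ 2) := by
    nlinarith only [hlo]
  exact le_of_mul_le_mul_right h1 (by positivity)

/-! ## §144 One step of `√(d² + ã²)`: the triangle inequality in the output plane -/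

/-- **THE LADDER STEP.** If `|d| ≤ |d₀| + x` and `0 ≤ e ≤ e₀ + y` (`x, y ≥ 0`) then
`√(d² + e²) ≤ √(d₀² + e₀²) + x + y`. [cite: Tao2016AveragedNS, §5.5 Theorem 5.3] -/
theorem pair_sqrt_step {d e d₀ e₀ x y : ℝ} (hd : |d| ≤ |d₀| + x) (he0 : 0 ≤ e) (he : e ≤ e₀ + y)
    (hx : 0 ≤ x) (hy : 0 ≤ y) :
    √(d ^ 2 + e ^ 2) ≤ √(d₀ ^ 2 + e₀ ^ 2) + x + y := by
  set S := √(d₀ ^ 2 + e₀ ^ 2) with hS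
  have hS0 : 0 ≤ S := Real.sqrt_nonneg _
  have hS2 : S ^ 2 = d₀ ^ 2 + e₀ ^ 2 := Real.sq_sqrt (by positivity)
  have hdS : |d₀| ≤ S := Real.abs_le_sqrt (by nlinarith only [sq_nonneg e₀])
  have heS : e₀ ≤ S := (le_abs_self e₀).trans (Real.abs_le_sqrt (by nlinarith only [sq_nonneg d₀]))
  have hd2 : d ^ 2 ≤ (|d₀| + x) ^ 2 := by
    have h := pow_le_pow_left₀ (abs_nonneg d) hd 2; rwa [sq_abs] at h
  have he2 : e ^ 2 ≤ (e₀ + y) ^ 2 := pow_le_pow_left₀ he0 he 2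
  calc √(d ^ 2 + e ^ 2) ≤ √((S + x + y) ^ 2) := by
        apply Real.sqrt_le_sqrt
        nlinarith only [hd2, he2, hS2, sq_abs d₀, mul_le_mul_of_nonneg_right hdS hx,
          mul_le_mul_of_nonneg_right heS hy, mul_nonneg hx hy]
    _ = S + x + y := Real.sqrt_sq (by positivity)

end Summit.NavierStokesRegularity.FluidComputer.GateBudget
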